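import Mathlib.Analysis.Calculus.Deriv.MeanValue
import Literature.NumberTheory.LFunctions.DeBruijnPhiSecondDeriv
import Literature.NumberTheory.LFunctions.WeilOddThetaVector
import HarnessLib

/-!
# Riemann's kernel `Φ` is strictly decreasing on `[0, ∞)` (Wintner 1935); the odd theta vector is positive

Topic `Literature/NumberTheory/LFunctions`; companion of `DeBruijnNewman.lean`, `DeBruijnPhiDeriv.lean`,
`DeBruijnPhiSecondDeriv.lean` (toolbox) and `WeilOddThetaVector.lean`. For the tree's Rodgers–Tao-normalised
Pólya–de Bruijn kernel `Φ(u) = deBruijnPhi u = ∑_{n ≥ 1} (2π²n⁴e^{9u} − 3πn²e^{5u}) exp(−πn²e^{4u})`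
(Titchmarsh's `Φ_T(t) = 2Φ(t/2) = weilThetaPhi t`, Lagarias–Montague's `Φ_LM = Φ_T`) we PROVE

* `deBruijnPhiDeriv_neg_of_pos`: `Φ′(u) < 0` for every `u > 0`;
* `strictAntiOn_deBruijnPhi`: `Φ` is strictly decreasing on `[0, ∞)` (and strictly increasing on
  `(−∞, 0]`, `strictMonoOn_deBruijnPhi`, by evenness), with a strict global maximum at `0`,

i.e. Lagarias–Montague 2011, Lemma 3.1 (5) ("`Φ(u)` is a strictly decreasing function on `[0, ∞)`";
"The decreasing property of `Φ(u)` was proved in 1935 by Wintner [Wi35]"), equivalently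
Csordas–Norfolk–Varga 1986, Theorem A (`Φ′(t) < 0` for `t > 0`); and the consequences for Weil's additive
variable (`WeilOddThetaVector.lean`): `weilThetaPhiDeriv < 0` on `(0, ∞)`, `weilThetaPhi` strictly
decreasing on `[0, ∞)`, and the ODD THETA VECTOR `H_a = weilOddThetaVector a = −Φ′𝟙_{[−a,a]}` is `> 0` on
`(0, a]`, `< 0` on `[−a, 0)`, and nonzero in `L²` for `a > 0` (the sign input of the odd-sector Barta
inequality of route `RiemannHypothesis/OddSector`).

## Proof (elementary; not Wintner's)

With `x = e^{4u}` and `y_n = π n² x`, `Φ′(u) = −eᵘ ∑_{n≥1} y_n (8y_n² − 30y_n + 15) e^{−y_n}`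
(`deBruijnPhiDeriv_eq_tsum`).
1. For `u ≥ 1/96` one has `y_1 = πx ≥ 3.27`, where `8y² − 30y + 15 > 0`; all terms are positive and
   `Φ′(u) < 0` (`deBruijnPhiDeriv_neg_of_ge`). Near `u = 0` this fails: the `n = 1` term is negative and
   `Φ′(0) = 0` only by the theta functional equation (evenness of `Φ`, `deBruijnPhiDeriv_zero`).
2. On `[0, 1/96]`, `Φ″(u) = eᵘ ∑_{n≥1} y_n (32y_n³ − 224y_n² + 330y_n − 75) e^{−y_n}`
   (`deBruijnPhiDeriv₂_eq_tsum`). The `n = 1` term has `y_1 ∈ [3.14, 3.29]`, where the cubic is `≤ −240`,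
   so it is `≤ −240 · 3.14 / 28 ≤ −26`; the terms `n ≥ 2` have `y_n ≥ 4π`, are positive, and are bounded
   by `35 y_n⁴ e^{−y_n} ≤ 1750 e^{−y_n/2} ≤ 1750 (1/23)^n`, of total `≤ 1750/506 < 3.5`. Hence `Φ″ < 0` on
   `[0, 1/96]`, `Φ′` is strictly decreasing there, and `Φ′(u) < Φ′(0) = 0` for `0 < u ≤ 1/96`.

## References

* J. C. Lagarias, D. Montague, *The integral of the Riemann ξ-function*, Comment. Math. Univ. St. Pauli
  60 (2011), Lemma 3.1 (5). [LagariasMontague2011]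
* A. Wintner, *A note on the Riemann ξ-function*, J. London Math. Soc. 10 (1935), 82–83.
* G. Csordas, T. S. Norfolk, R. S. Varga, *The Riemann hypothesis and the Turán inequalities*,
  Trans. AMS 296 (1986), Theorem A. [CsordasNorfolkVarga1986]
-/

noncomputable section

open Filter Topology Set MeasureTheory
open scoped Real

namespace Literature.NumberTheory.LFunctions

/-! ## 4. Large `u`: every term of `Φ′` has the right sign -/

/-- `8y² − 30y + 15 > 0` for `y ≥ 3.27` (the larger root is `(30 + √420)/16 ≈ 3.156`). [folklore] -/
theorem wintner_quadratic_pos {y : ℝ} (hy : 3.27 ≤ y) : 0 < 8 * y ^ 2 - 30 * y + 15 := by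
  nlinarith [sq_nonneg (y - 3.27)]

/-- For `u ≥ 1/96`: `π e^{4u} ≥ 3.27`. [folklore] -/
theorem wintner_pi_mul_exp_ge {u : ℝ} (hu : 1 / 96 ≤ u) : 3.27 ≤ π * rexp (4 * u) := by
  have h1 : 1 + 1 / 24 ≤ rexp (4 * u) := by
    have := Real.add_one_le_exp (4 * u)
    linarith
  have := Real.pi_gt_d2
  nlinarith

/-- **Case `u ≥ 1/96`**: `Φ′(u) < 0`, every term `y_n(8y_n² − 30y_n + 15)e^{−y_n}` of
`deBruijnPhiDeriv_eq_tsum` being positive (`y_n ≥ π e^{4u} ≥ 3.27`). [folklore] -/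
theorem deBruijnPhiDeriv_neg_of_ge {u : ℝ} (hu : 1 / 96 ≤ u) : deBruijnPhiDeriv u < 0 := by
  rw [deBruijnPhiDeriv_eq_tsum, neg_lt_zero]
  refine mul_pos (Real.exp_pos u) ?_
  have hx : 0 < rexp (4 * u) := Real.exp_pos _
  have hterm : ∀ n, 0 < phiPolyTerm 15 (-30) 8 0 (rexp (4 * u)) n := fun n => by
    have hy : 3.27 ≤ thetaFreq (rexp (4 * u)) n :=
      (wintner_pi_mul_exp_ge hu).trans (pi_mul_le_thetaFreq hx.le n)
    have hq := wintner_quadratic_pos hy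
    unfold phiPolyTerm
    refine mul_pos ?_ (Real.exp_pos _)
    have hy0 : 0 < thetaFreq (rexp (4 * u)) n := by linarith
    nlinarith [mul_pos hy0 hq]
  exact (summable_phiPolyTerm _ _ _ _ hx).tsum_pos (fun n => (hterm n).le) 0 (hterm 0)

/-! ## 5. Small `u`: `Φ″ < 0` on `[0, 1/96]` -/

/-- The cubic `32y³ − 224y² + 330y − 75` is `≤ −240` on `[3.14, 3.29]`. [folklore] -/
theorem wintner_cubic_le {y : ℝ} (h1 : 3.14 ≤ y) (h2 : y ≤ 3.29) :
    32 * y ^ 3 - 224 * y ^ 2 + 330 * y - 75 ≤ -240 := by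
  have hs : 0 ≤ y - 3.14 := by linarith
  have ht : 0 ≤ 3.29 - y := by linarith
  nlinarith [mul_nonneg hs ht, mul_nonneg (mul_nonneg hs hs) ht, mul_nonneg hs hs]

/-- **The first term of `Φ″`**: for `1 ≤ x ≤ 24/23` (so `y_0 = πx ∈ [3.14, 3.29]`),
`y_0(32y_0³ − 224y_0² + 330y_0 − 75)e^{−y_0} ≤ 3.14 · (−240) / 28 ≤ −26`. [folklore] -/
theorem phiPolyTerm_zero_le {x : ℝ} (hx1 : 1 ≤ x) (hx2 : x ≤ 24 / 23) :
    phiPolyTerm (-75) 330 (-224) 32 x 0 ≤ -26 := by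
  have hπ1 := Real.pi_gt_d2
  have hπ2 := Real.pi_lt_d2
  have hy : thetaFreq x 0 = π * x := by simp [thetaFreq]
  have hy1 : 3.14 ≤ π * x := by nlinarith
  have hy2 : π * x ≤ 3.29 := by nlinarith
  have hc := wintner_cubic_le hy1 hy2
  -- the polynomial factor `q = y · cubic ≤ 3.14 · (−240)`
  have hq : -75 * (π * x) + 330 * (π * x) ^ 2 + -224 * (π * x) ^ 3 + 32 * (π * x) ^ 4 ≤
      3.14 * (-240) := by
    have e : -75 * (π * x) + 330 * (π * x) ^ 2 + -224 * (π * x) ^ 3 + 32 * (π * x) ^ 4 =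
        (π * x) * (32 * (π * x) ^ 3 - 224 * (π * x) ^ 2 + 330 * (π * x) - 75) := by ring
    rw [e]
    nlinarith
  -- `e^{−y} ≥ 1/28`
  have he : 1 / 28 ≤ rexp (-(π * x)) := by
    rw [Real.exp_neg, ← one_div]
    apply one_div_le_one_div_of_le (Real.exp_pos _)
    exact ((Real.exp_le_exp.2 hy2).trans wintner_exp_329_lt.le)
  rw [phiPolyTerm, hy]
  calc (-75 * (π * x) + 330 * (π * x) ^ 2 + -224 * (π * x) ^ 3 + 32 * (π * x) ^ 4) * rexp (-(π * x))
      ≤ (-75 * (π * x) + 330 * (π * x) ^ 2 + -224 * (π * x) ^ 3 + 32 * (π * x) ^ 4) * (1 / 28) :=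
        mul_le_mul_of_nonpos_left he (by linarith)
    _ ≤ 3.14 * (-240) * (1 / 28) := mul_le_mul_of_nonneg_right hq (by norm_num)
    _ ≤ -26 := by norm_num

/-- **The tail terms of `Φ″`**: for `1 ≤ x`, the term of index `n + 1` (frequency
`y = π(n+2)²x ≥ 4π`) satisfies `0 ≤ · ≤ 35 y⁴e^{−y} ≤ 1750 e^{−y/2} ≤ 1750 (1/23)^{n+2}`. [folklore] -/
theorem phiPolyTerm_succ_le {x : ℝ} (hx1 : 1 ≤ x) (n : ℕ) :
    phiPolyTerm (-75) 330 (-224) 32 x (n + 1) ≤ 1750 * ((1 / 23) ^ 2 * (1 / 23) ^ n) := by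
  have hπ := Real.pi_gt_d2
  set y := thetaFreq x (n + 1) with hydef
  have hy4 : 4 * π ≤ y := by
    have := four_pi_mul_le_thetaFreq_succ (zero_le_one.trans hx1) n
    nlinarith [Real.pi_pos]
  have hy11 : 11 ≤ y := by nlinarith
  -- (ii) polynomial part ≤ 35 y⁴
  have hpoly : -75 * y + 330 * y ^ 2 + -224 * y ^ 3 + 32 * y ^ 4 ≤ 35 * y ^ 4 := by
    have h110 : 110 ≤ y ^ 2 := by nlinarith
    nlinarith [sq_nonneg y, mul_nonneg (by norm_num : (0:ℝ) ≤ 3) (sq_nonneg y)]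
  -- (iv) `e^{−y/2} ≤ e^{−π(n+2)}` and (v) `≤ (1/23)^{n+2}`
  have hfreq : π * ((n : ℝ) + 2) ≤ y / 2 := by
    have e : y = π * ((n : ℝ) + 2) ^ 2 * x := by
      rw [hydef, thetaFreq]; push_cast; ring
    rw [e]
    have hn : (0 : ℝ) ≤ n := n.cast_nonneg
    have h2 : (2 : ℝ) ≤ ((n : ℝ) + 2) * x := by nlinarith
    nlinarith [Real.pi_pos, mul_nonneg Real.pi_pos.le hn]
  have hgeom : rexp (-y / 2) ≤ (1 / 23) ^ 2 * (1 / 23) ^ n := by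
    calc rexp (-y / 2) ≤ rexp (((n + 2 : ℕ) : ℝ) * (-π)) := Real.exp_le_exp.2 (by push_cast; linarith)
      _ = rexp (-π) ^ (n + 2) := Real.exp_nat_mul _ _
      _ ≤ (1 / 23) ^ (n + 2) := by
          gcongr
          exact wintner_exp_neg_pi_lt.le
      _ = (1 / 23) ^ 2 * (1 / 23) ^ n := by ring
  calc phiPolyTerm (-75) 330 (-224) 32 x (n + 1)
      = (-75 * y + 330 * y ^ 2 + -224 * y ^ 3 + 32 * y ^ 4) * rexp (-y) := rfl
    _ ≤ 35 * y ^ 4 * rexp (-y) := by gcongr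
    _ = 35 * (y ^ 4 * rexp (-y)) := by ring
    _ ≤ 35 * (50 * rexp (-y / 2)) := mul_le_mul_of_nonneg_left (wintner_pow_four_mul_exp_neg_le hy4) (by norm_num)
    _ = 1750 * rexp (-y / 2) := by ring
    _ ≤ 1750 * ((1 / 23) ^ 2 * (1 / 23) ^ n) := by gcongr

/-- The tail of `Φ″` is at most `1750/506 < 3.5`: `∑_{n≥0} T_{n+1} ≤ 1750 · (1/23)² / (1 − 1/23)`.
[folklore] -/
theorem tsum_phiPolyTerm_succ_le {x : ℝ} (hx1 : 1 ≤ x) :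
    ∑' n, phiPolyTerm (-75) 330 (-224) 32 x (n + 1) ≤ 1750 / 506 := by
  have hx : 0 < x := by linarith
  have hs : Summable fun n => phiPolyTerm (-75) 330 (-224) 32 x (n + 1) :=
    (summable_nat_add_iff 1).2 (summable_phiPolyTerm _ _ _ _ hx)
  have hg : Summable fun n : ℕ => (1750 : ℝ) * ((1 / 23) ^ 2 * (1 / 23) ^ n) :=
    ((summable_geometric_of_lt_one (by norm_num) (by norm_num)).mul_left _).mul_left _
  refine (hs.tsum_le_tsum (phiPolyTerm_succ_le hx1) hg).trans (le_of_eq ?_)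
  rw [tsum_mul_left, tsum_mul_left, tsum_geometric_of_lt_one (by norm_num) (by norm_num)]
  norm_num

/-- **Case `0 ≤ u ≤ 1/96`**: `Φ″(u) ≤ eᵘ(−26 + 1750/506) < 0`. [folklore] -/
theorem deBruijnPhiDeriv₂_neg {u : ℝ} (hu0 : 0 ≤ u) (hu : u ≤ 1 / 96) : deBruijnPhiDeriv₂ u < 0 := by
  have hx : 0 < rexp (4 * u) := Real.exp_pos _
  have hx1 : 1 ≤ rexp (4 * u) := Real.one_le_exp (by linarith)
  have hx2 : rexp (4 * u) ≤ 24 / 23 :=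
    (Real.exp_le_exp.2 (by linarith : 4 * u ≤ 1 / 24)).trans wintner_exp_one_div_24_le
  rw [deBruijnPhiDeriv₂_eq_tsum, (summable_phiPolyTerm _ _ _ _ hx).tsum_eq_zero_add]
  refine mul_neg_of_pos_of_neg (Real.exp_pos u) ?_
  have h0 := phiPolyTerm_zero_le hx1 hx2
  have h1 := tsum_phiPolyTerm_succ_le hx1
  have : (1750 : ℝ) / 506 < 26 := by norm_num
  linarith

/-- `Φ′` is strictly decreasing on `[0, 1/96]`. [folklore] -/
theorem strictAntiOn_deBruijnPhiDeriv : StrictAntiOn deBruijnPhiDeriv (Icc 0 (1 / 96)) :=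
  strictAntiOn_of_deriv_neg (convex_Icc 0 (1 / 96)) continuous_deBruijnPhiDeriv.continuousOn
    fun x hx => by
      rw [interior_Icc] at hx
      rw [deriv_deBruijnPhiDeriv]
      exact deBruijnPhiDeriv₂_neg hx.1.le hx.2.le

/-! ## 6. Conclusion -/

/-- **`Φ′ < 0` on `(0, ∞)`** (Wintner 1935; Lagarias–Montague 2011, Lemma 3.1 (5); Csordas–Norfolk–Varga
1986, Thm. A): for `u > 0`, `deBruijnPhiDeriv u < 0`. [cite: LagariasMontague2011, Lemma 3.1 (5)] -/
theorem deBruijnPhiDeriv_neg_of_pos {u : ℝ} (hu : 0 < u) : deBruijnPhiDeriv u < 0 := by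
  rcases le_or_gt (1 / 96) u with h | h
  · exact deBruijnPhiDeriv_neg_of_ge h
  · have := strictAntiOn_deBruijnPhiDeriv ⟨le_rfl, by norm_num⟩ ⟨hu.le, h.le⟩ hu
    rwa [deBruijnPhiDeriv_zero] at this

/-- `Φ′ ≤ 0` on `[0, ∞)`. [folklore] -/
theorem deBruijnPhiDeriv_nonpos {u : ℝ} (hu : 0 ≤ u) : deBruijnPhiDeriv u ≤ 0 := by
  rcases hu.eq_or_lt with h | h
  · rw [← h, deBruijnPhiDeriv_zero]
  · exact (deBruijnPhiDeriv_neg_of_pos h).le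

/-- `Φ′ > 0` on `(−∞, 0)` (`Φ′` is odd). [folklore] -/
theorem deBruijnPhiDeriv_pos_of_neg {u : ℝ} (hu : u < 0) : 0 < deBruijnPhiDeriv u := by
  have h := deBruijnPhiDeriv_neg (-u)
  rw [neg_neg] at h
  have := deBruijnPhiDeriv_neg_of_pos (by linarith : 0 < -u)
  linarith

/-- **`Φ` is strictly decreasing on `[0, ∞)`** (Lagarias–Montague 2011, Lemma 3.1 (5): "`Φ(u)` is a
strictly decreasing function on `[0, ∞)`", proved by Wintner 1935). [cite: LagariasMontague2011, Lemma 3.1 (5)] -/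
theorem strictAntiOn_deBruijnPhi : StrictAntiOn deBruijnPhi (Ici 0) :=
  strictAntiOn_of_deriv_neg (convex_Ici 0) continuous_deBruijnPhi.continuousOn fun x hx => by
    rw [interior_Ici] at hx
    rw [(hasDerivAt_deBruijnPhi x).deriv]
    exact deBruijnPhiDeriv_neg_of_pos hx

/-- `Φ` is strictly increasing on `(−∞, 0]` (evenness). [folklore] -/
theorem strictMonoOn_deBruijnPhi : StrictMonoOn deBruijnPhi (Iic 0) :=
  strictMonoOn_of_deriv_pos (convex_Iic 0) continuous_deBruijnPhi.continuousOn fun x hx => by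
    rw [interior_Iic] at hx
    rw [(hasDerivAt_deBruijnPhi x).deriv]
    exact deBruijnPhiDeriv_pos_of_neg hx

/-- `Φ(u) < Φ(0)` for `u ≠ 0`: the kernel has a strict global maximum at the origin. [folklore] -/
theorem deBruijnPhi_lt_deBruijnPhi_zero {u : ℝ} (hu : u ≠ 0) : deBruijnPhi u < deBruijnPhi 0 := by
  rcases lt_or_gt_of_ne hu with h | h
  · rw [← deBruijnPhi_neg_holds u]
    exact strictAntiOn_deBruijnPhi (mem_Ici.2 le_rfl) (mem_Ici.2 (by linarith)) (by linarith)
  · exact strictAntiOn_deBruijnPhi (mem_Ici.2 le_rfl) (mem_Ici.2 h.le) h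

/-- `Φ(u) ≤ Φ(0)` for all `u`. [folklore] -/
theorem deBruijnPhi_le_deBruijnPhi_zero (u : ℝ) : deBruijnPhi u ≤ deBruijnPhi 0 := by
  rcases eq_or_ne u 0 with h | h
  · rw [h]
  · exact (deBruijnPhi_lt_deBruijnPhi_zero h).le

/-! ## 7. Consequences in Weil's additive variable: `Φ_W′ < 0` on `(0,∞)`, `H_a > 0` on `(0, a]` -/

section Weil

variable {a t : ℝ}

/-- `Φ′(t) = weilThetaPhiDeriv t < 0` for `t > 0` (Riemann's kernel of Weil's additive variable,
`Φ(t) = 2 deBruijnPhi (t/2)`, is strictly decreasing on `[0, ∞)`). [cite: LagariasMontague2011, Lemma 3.1 (5)] -/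
theorem weilThetaPhiDeriv_neg_of_pos (ht : 0 < t) : weilThetaPhiDeriv t < 0 := by
  show deBruijnPhiDeriv (t / 2) < 0
  exact deBruijnPhiDeriv_neg_of_pos (by positivity)

/-- `weilThetaPhiDeriv t > 0` for `t < 0`. [folklore] -/
theorem weilThetaPhiDeriv_pos_of_neg (ht : t < 0) : 0 < weilThetaPhiDeriv t := by
  show 0 < deBruijnPhiDeriv (t / 2)
  exact deBruijnPhiDeriv_pos_of_neg (by linarith)

/-- `weilThetaPhiDeriv t ≤ 0` for `t ≥ 0`. [folklore] -/
theorem weilThetaPhiDeriv_nonpos (ht : 0 ≤ t) : weilThetaPhiDeriv t ≤ 0 := by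
  show deBruijnPhiDeriv (t / 2) ≤ 0
  exact deBruijnPhiDeriv_nonpos (by positivity)

/-- `Φ = weilThetaPhi` is strictly decreasing on `[0, ∞)` (Lagarias–Montague Lemma 3.1 (5), as printed,
for the printed kernel (3.4) = Titchmarsh (10.1.4)). [cite: LagariasMontague2011, Lemma 3.1 (5)] -/
theorem strictAntiOn_weilThetaPhi : StrictAntiOn weilThetaPhi (Ici 0) :=
  strictAntiOn_of_deriv_neg (convex_Ici 0) continuous_weilThetaPhi.continuousOn fun x hx => by
    rw [interior_Ici] at hx
    rw [(hasDerivAt_weilThetaPhi x).deriv]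
    exact weilThetaPhiDeriv_neg_of_pos hx

/-- `weilThetaPhi` is strictly increasing on `(−∞, 0]`. [folklore] -/
theorem strictMonoOn_weilThetaPhi : StrictMonoOn weilThetaPhi (Iic 0) :=
  strictMonoOn_of_deriv_pos (convex_Iic 0) continuous_weilThetaPhi.continuousOn fun x hx => by
    rw [interior_Iic] at hx
    rw [(hasDerivAt_weilThetaPhi x).deriv]
    exact weilThetaPhiDeriv_pos_of_neg hx

/-- `Φ(t) < Φ(0)` for `t ≠ 0`. [folklore] -/
theorem weilThetaPhi_lt_weilThetaPhi_zero (ht : t ≠ 0) : weilThetaPhi t < weilThetaPhi 0 := by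
  rw [weilThetaPhi, weilThetaPhi, zero_div]
  exact mul_lt_mul_of_pos_left (deBruijnPhi_lt_deBruijnPhi_zero (by simpa using ht)) two_pos

/-- **The odd theta vector is positive on the right half-window**: `H_a(t) > 0` for `0 < t ≤ a`.
[folklore] -/
theorem weilOddThetaVector_pos (ht : 0 < t) (hta : t ≤ a) : 0 < weilOddThetaVector a t := by
  rw [weilOddThetaVector_of_mem ⟨by linarith, hta⟩, neg_pos]
  exact weilThetaPhiDeriv_neg_of_pos ht

/-- `H_a(t) < 0` for `−a ≤ t < 0`. [folklore] -/
theorem weilOddThetaVector_neg_of_neg (ht : t < 0) (hta : -a ≤ t) : weilOddThetaVector a t < 0 := by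
  rw [weilOddThetaVector_of_mem ⟨hta, by linarith⟩, neg_lt_zero]
  exact weilThetaPhiDeriv_pos_of_neg ht

/-- `H_a ≥ 0` on `[0, ∞)`. [folklore] -/
theorem weilOddThetaVector_nonneg (a : ℝ) (ht : 0 ≤ t) : 0 ≤ weilOddThetaVector a t := by
  by_cases h : t ∈ Icc (-a) a
  · rw [weilOddThetaVector_of_mem h, neg_nonneg]
    exact weilThetaPhiDeriv_nonpos ht
  · rw [weilOddThetaVector_of_not_mem h]

/-- `H_a ≤ 0` on `(−∞, 0]` (oddness). [folklore] -/
theorem weilOddThetaVector_nonpos (a : ℝ) (ht : t ≤ 0) : weilOddThetaVector a t ≤ 0 := by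
  have h := weilOddThetaVector_nonneg a (neg_nonneg.2 ht)
  rw [weilOddThetaVector_neg] at h
  linarith

/-- **Non-vacuity in `L²`**: for `a > 0` the odd theta vector is not the zero vector of `L²`:
`∫ H_a² > 0` (its support contains `(0, a)`). [folklore] -/
theorem integral_sq_weilOddThetaVector_pos (ha : 0 < a) : 0 < ∫ t, weilOddThetaVector a t ^ 2 := by
  rw [integral_pos_iff_support_of_nonneg (fun t => sq_nonneg _) (integrable_sq_weilOddThetaVector a)]
  have hsub : Ioo 0 a ⊆ Function.support fun t => weilOddThetaVector a t ^ 2 := fun t ht =>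
    Function.mem_support.2 (pow_pos (weilOddThetaVector_pos ht.1 ht.2.le) 2).ne'
  calc (0 : ENNReal) < volume (Ioo 0 a) := by simp [Real.volume_Ioo, ha]
    _ ≤ volume (Function.support fun t => weilOddThetaVector a t ^ 2) := measure_mono hsub

/-- For `a > 0`, `H_a ≠ 0`. [folklore] -/
theorem weilOddThetaVector_ne_zero (ha : 0 < a) : weilOddThetaVector a ≠ 0 := fun h => by
  have := weilOddThetaVector_pos ha le_rfl
  rw [h, Pi.zero_apply] at this
  exact lt_irrefl 0 this

end Weil

end Literature.NumberTheory.LFunctions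

end
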